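import Summits.HodgeConjecture.HodgeConjecture.Theses.LinearSystemTorelli
import Literature.Barriers.HodgeConjecture.GeneralizedHodgeTrivialReasonsSubHodgeProofs
import Literature.AlgebraicGeometry.Resolution.ProjectiveResolutionProofs
import Literature.AlgebraicGeometry.Motives.ComplexPointsOrientation

/-!
# Crux `TranscendentalOrSupported` (stmt-HodgeConjecture-10853), line `Sketch` — REMARKS (lead c2):
# the Gysin form `G¹` of coniveau one versus the kernel form `N¹`, and the two residues

Companion of `Lines/Sketch.lean` (skeleton v6, Gysin form), kept out of the skeleton so that
`TranscendentalOrSupported_of` stays its only theorem concluding the crux. Notation, for `X` smooth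
projective of dimension `n` and a degree `k`:

* `N¹ Hᵏ(X) = supportedClasses X k 1` — classes dying off some Zariski-closed subset of codimension
  `≥ 1` (Grothendieck's KERNEL description, the tree's definition);
* `G¹ Hᵏ(X) = ⨆ im (g_* : Hᵃ(Y(ℂ); ℂ) → Hᵏ(X(ℂ); ℂ))` over all orientation families `μ`, all smooth
  projective `Y` of dimension `m < n`, all `g : Y ⟶ X` and all degrees `a + 2n = k + 2m`
  (Grothendieck's GYSIN description, Topology 8 (1969) p. 300: "`Filt'ᵖ` can be also described as
  the space generated by the images of the Gysin homomorphisms").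

PROVED here:
* `gysinSpan_le_supportedClasses` — `G¹ ≤ N¹` unconditionally (Gysin images die off the proper
  closed image; the tree's `complexGysin_mem_supportedClasses`), as in the skeleton;
* `supportedClasses_le_gysinSpan` — `N¹ ≤ G¹` GRANTED Deligne's Hodge III Cor. 8.2.8 (the named fact
  `Deligne1974_ker_restrictCompl_eq_iSup_range_complexGysin`, hypothesis `hD`), with Hironaka's
  resolution a THEOREM of the tree (`Hironaka1964_projective_holds`): a class dying off `Z` dies off
  `⋃ⱼ gⱼ(Yⱼ) = Z` for a resolving family (`exists_family_iUnion_range_eq`) and is then a sum of Gysin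
  images (`Deligne….mem_iSup_range`); hence `gysinSpan_eq_supportedClasses : G¹ = N¹` under `hD`;
* `phantomIrreducible_of_phantomGysin` — the v6 residue (`W ⊓ G¹ ≠ ⊥`) implies the v5 residue
  (`W ⊓ N¹ ≠ ⊥`) unconditionally, and `phantomGysin_of_phantomIrreducible` — the converse under `hD`;
* `phantomGysin_of_transcendentalOrSupported` — the crux implies the v6 residue under `hD` (apply
  the crux to the rational spanning family: `W ≤ N¹ = G¹`, and `W ≠ ⊥`).

So, modulo the classical theorem Cor. 8.2.8 (not used by the skeleton any more), v6's
`stub_phantomGysin` = v5's `stub_phantomIrreducible` = the crux minus its Hodge-conjecture part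
(`Lines/Sketch_sectors.lean` for the v5 statement of the latter).
-/

noncomputable section

set_option linter.dupNamespace false

open CategoryTheory
open Literature.AlgebraicGeometry.Motives Literature.AlgebraicGeometry.HodgeTheory
open Literature.AlgebraicTopology.SingularHomology

namespace Summit.HodgeConjecture.HodgeConjecture.Cruxes.TranscendentalOrSupported.IsotypicBootstrap

variable {n : ℕ} {X : SchemeOver ℂ}

/-- **`G¹ ≤ N¹`, unconditionally** (as in the skeleton): a Gysin image from a smooth projective `Y`
of dimension `m < n` is supported on the proper closed image (`complexGysin_mem_supportedClasses`,
fed with the theorems `gysinMap_restrictCompl_eq_zero_of_field ℂ` and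
`OrientationFamily.hasPoincareDuality`). [cite: GrothendieckTopology1969, §1 and p. 300] -/
theorem gysinSpan_le_supportedClasses (hX : IsSmoothProjective n X) (k : ℕ) :
    (⨆ (μ : OrientationFamily) (m : ℕ) (_ : m < n) (Y : SchemeOver ℂ) (hY : IsSmoothProjective m Y)
        (g : Y ⟶ X) (a : ℕ) (hab : a + 2 * n = k + 2 * m),
        LinearMap.range (complexGysin μ hY hX g hab)) ≤ supportedClasses X k 1 := by
  refine iSup_le fun μ ↦ iSup_le fun m ↦ iSup_le fun hm ↦ iSup_le fun Y ↦ iSup_le fun hY ↦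
    iSup_le fun g ↦ iSup_le fun a ↦ iSup_le fun hab ↦ ?_
  rintro _ ⟨y, rfl⟩
  exact complexGysin_mem_supportedClasses (gysinMap_restrictCompl_eq_zero_of_field ℂ) μ
    μ.hasPoincareDuality hY hX g hab (r := 0) (s := 1) (by omega)
    (by rw [supportedClasses_zero]; exact Submodule.mem_top)

/-- **`N¹ ≤ G¹`, granted Deligne's Cor. 8.2.8** (`hD`): a class `x ∈ N¹ Hᵏ` dies off ONE closed `Z`
of codimension `≥ 1` (`exists_isClosed_of_mem_supportedClasses`); `Z = ⋃ⱼ gⱼ(Yⱼ)` for finitely many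
`gⱼ : Yⱼ ⟶ X` from smooth projective `Yⱼ` of dimensions `mⱼ < n` (`exists_family_iUnion_range_eq`,
Hironaka — the tree's theorem `Hironaka1964_projective_holds`); so `x ∈ Σⱼ im (gⱼ)_*`
(`Deligne1974_ker_restrictCompl_eq_iSup_range_complexGysin.mem_iSup_range`), inside `G¹`.
[cite: DeligneHodgeIII1974, Cor. 8.2.8] [cite: GrothendieckTopology1969, p. 300] -/
theorem supportedClasses_le_gysinSpan (hD : Deligne1974_ker_restrictCompl_eq_iSup_range_complexGysin)
    (hX : IsSmoothProjective n X) (k : ℕ) :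
    supportedClasses X k 1 ≤
      ⨆ (μ : OrientationFamily) (m : ℕ) (_ : m < n) (Y : SchemeOver ℂ) (hY : IsSmoothProjective m Y)
        (g : Y ⟶ X) (a : ℕ) (hab : a + 2 * n = k + 2 * m),
        LinearMap.range (complexGysin μ hY hX g hab) := by
  intro x hx
  obtain ⟨Z, hZ, hZ1, hxZ⟩ := exists_isClosed_of_mem_supportedClasses hx
  obtain ⟨ι, _, m, Y, hY, g, hm, hZeq⟩ :=
    exists_family_iUnion_range_eq Literature.AlgebraicGeometry.Resolution.Hironaka1964_projective_holds
      hX hZ (fun z hz ↦ by exact_mod_cast hZ1 z hz)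
  let μ : OrientationFamily := fun _ _ h ↦ Classical.choice (ComplexPoints.isOrientableOver ℂ h)
  have hx' : complexBetti.restrictCompl X (⋃ j, Set.range (g j).left.base) k x = 0 := by
    rw [hZeq]; exact hxZ
  have hmem := hD.mem_iSup_range μ μ.hasPoincareDuality hX hY g hx'
  revert hmem
  refine fun hmem ↦ (iSup_le fun j ↦ iSup_le fun a ↦ iSup_le fun hab ↦ ?_ :
    (⨆ (j : ι) (a : ℕ) (hab : a + 2 * n = k + 2 * m j),
      LinearMap.range (complexGysin μ (hY j) hX (g j) hab)) ≤ _) hmem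
  exact le_iSup_of_le μ (le_iSup_of_le (m j) (le_iSup_of_le (hm j) (le_iSup_of_le (Y j)
    (le_iSup_of_le (hY j) (le_iSup_of_le (g j) (le_iSup_of_le a (le_iSup_of_le hab le_rfl)))))))

/-- **`G¹ = N¹` granted Deligne's Cor. 8.2.8** — Grothendieck's two descriptions of coniveau `≥ 1`
agree. [cite: GrothendieckTopology1969, p. 300] [cite: DeligneHodgeIII1974, Cor. 8.2.8] -/
theorem gysinSpan_eq_supportedClasses (hD : Deligne1974_ker_restrictCompl_eq_iSup_range_complexGysin)
    (hX : IsSmoothProjective n X) (k : ℕ) :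
    (⨆ (μ : OrientationFamily) (m : ℕ) (_ : m < n) (Y : SchemeOver ℂ) (hY : IsSmoothProjective m Y)
        (g : Y ⟶ X) (a : ℕ) (hab : a + 2 * n = k + 2 * m),
        LinearMap.range (complexGysin μ hY hX g hab)) = supportedClasses X k 1 :=
  le_antisymm (gysinSpan_le_supportedClasses hX k) (supportedClasses_le_gysinSpan hD hX k)

/-- **The v6 residue implies the v5 residue, unconditionally**: if `W` meets `G¹` non-trivially it
meets `N¹ ⊇ G¹` non-trivially. -/
theorem phantomIrreducible_of_phantomGysin {p : ℕ} (hX : IsSmoothProjective (2 * p) X)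
    (W : Submodule ℂ (complexBetti X (2 * p)))
    (h : W ⊓ (⨆ (μ : OrientationFamily) (m : ℕ) (_ : m < 2 * p) (Y : SchemeOver ℂ)
        (hY : IsSmoothProjective m Y) (g : Y ⟶ X) (a : ℕ) (hab : a + 2 * (2 * p) = 2 * p + 2 * m),
        LinearMap.range (complexGysin μ hY hX g hab)) ≠ ⊥) :
    W ⊓ supportedClasses X (2 * p) 1 ≠ ⊥ := fun h' ↦
  h (eq_bot_mono (inf_le_inf_left W (gysinSpan_le_supportedClasses hX (2 * p))) h')

/-- **The v5 residue implies the v6 residue, granted Deligne's Cor. 8.2.8** (`N¹ ≤ G¹`). -/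
theorem phantomGysin_of_phantomIrreducible
    (hD : Deligne1974_ker_restrictCompl_eq_iSup_range_complexGysin) {p : ℕ}
    (hX : IsSmoothProjective (2 * p) X) (W : Submodule ℂ (complexBetti X (2 * p)))
    (h : W ⊓ supportedClasses X (2 * p) 1 ≠ ⊥) :
    W ⊓ (⨆ (μ : OrientationFamily) (m : ℕ) (_ : m < 2 * p) (Y : SchemeOver ℂ)
        (hY : IsSmoothProjective m Y) (g : Y ⟶ X) (a : ℕ) (hab : a + 2 * (2 * p) = 2 * p + 2 * m),
        LinearMap.range (complexGysin μ hY hX g hab)) ≠ ⊥ := fun h' ↦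
  h (eq_bot_mono (inf_le_inf_left W (supportedClasses_le_gysinSpan hD hX (2 * p))) h')

/-- **The crux implies the v6 residue, granted Deligne's Cor. 8.2.8.** Under
`TranscendentalOrSupported`, the span `W` of rational `b j` (pulled back a sub-Hodge structure
without `(2p,0)`-part) lies in `N¹ = G¹`; if `dim W ≥ 2` then `W ≠ ⊥`, so `W ⊓ G¹ = W ≠ ⊥`.
(Irreducibility is not even needed.) With the skeleton (`Lines/Sketch.lean` v6: residue + three
landed stubs + item `MiddleDivisorSupport` ⟹ crux) this certifies that `stub_phantomGysin` is the
crux minus its Hodge-conjecture part, modulo Cor. 8.2.8. -/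
theorem phantomGysin_of_transcendentalOrSupported
    (hD : Deligne1974_ker_restrictCompl_eq_iSup_range_complexGysin)
    (hT : Summit.HodgeConjecture.HodgeConjecture.Theses.LinearSystemTorelli.TranscendentalOrSupported)
    {p : ℕ} (h2 : 2 ≤ p) (hX : IsSmoothProjective (2 * p) X) (A : HodgeModel (2 * p) X) (r : ℕ)
    (b : Fin r → complexBetti X (2 * p)) (hb : ∀ j, IsRationalClass (b j))
    (hsub : (Submodule.span ℂ (Set.range b)).map (A.pullback (2 * p)).hom =
      ⨆ (p' : ℕ) (q' : ℕ) (_ : p' + q' = 2 * p),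
        (Submodule.span ℂ (Set.range b)).map (A.pullback (2 * p)).hom ⊓ A.hodgePQ (2 * p) p' q')
    (hbot : (Submodule.span ℂ (Set.range b)).map (A.pullback (2 * p)).hom ⊓
      A.hodgePQ (2 * p) (2 * p) 0 = ⊥)
    (hrk : 2 ≤ Module.finrank ℂ (Submodule.span ℂ (Set.range b))) :
    Submodule.span ℂ (Set.range b) ⊓
      (⨆ (μ : OrientationFamily) (m : ℕ) (_ : m < 2 * p) (Y : SchemeOver ℂ)
        (hY : IsSmoothProjective m Y) (g : Y ⟶ X) (a : ℕ) (hab : a + 2 * (2 * p) = 2 * p + 2 * m),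
        LinearMap.range (complexGysin μ hY hX g hab)) ≠ ⊥ := by
  refine phantomGysin_of_phantomIrreducible hD hX _ ?_
  have hle : Submodule.span ℂ (Set.range b) ≤ supportedClasses X (2 * p) 1 := by
    rw [Submodule.span_le]
    rintro _ ⟨j, rfl⟩
    exact hT (by omega) hX A r b hb hsub hbot j
  rw [inf_eq_left.2 hle]
  intro h
  rw [h, finrank_bot] at hrk
  omega

end Summit.HodgeConjecture.HodgeConjecture.Cruxes.TranscendentalOrSupported.IsotypicBootstrap

end
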